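import Summits.RiemannHypothesis.RiemannHypothesis.Theorems.LiAsymptoticDefs
import Literature.NumberTheory.LFunctions.ZetaArgBacklundExplicit
import HarnessLib

/-!
# RiemannHypothesis / LiAsymptotic — the LOW zeros counted trivially (RH-FREE zero counting)

RH-FREE [rh-li-prover].  Support lemma of the rung L-P(P1⁺) «Li asymptotic law, quadratic range» (route dossier
`LiAsymptotic`, cell `pub/rh-li`, theory memo `theory/TARGETS.md` §11; the Assembly's birth stub
`stub_lowZerosTrivial`): for every `n` and every `a ≥ 30`,

  `|2 Σ_{0 < Im ρ ≤ a} m(ρ) f_n(Im ρ) − 2 M(a)| ≤ 2 M(a) + 4 (0.3083 log a + 4.128)`,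

where `f_n = liWindowWeight n ∈ [0, 2]`, `M(a) = liCountMain a = (a/2π) log(a/2πe)` and the sum runs over the zeros of
`ζ` in the closed critical strip with ordinates in `(0, a]` (`SchoenfeldBound.zerosBetween`, multiplicities
`riemannZetaZeroOrder`).  Proof: `0 ≤ Σ m f_n ≤ 2 N(a)` and the explicit two-sided count
`|N(a) − M(a)| ≤ 0.3083 log a + 4.128` (`abs_zetaZeroCount_sub_main_le_explicit`, `a ≥ 30`), with `M(a) ≥ 0` for
`a ≥ 2πe`.  Nothing about the real parts of the zeros is used; nothing here bears on the truth of RH.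
-/

noncomputable section

-- D-0017: `Summit.<S>.<S>.…` is the designed namespace of a single-problem summit.
set_option linter.dupNamespace false

open Real

namespace Summit.RiemannHypothesis.RiemannHypothesis.Theorems.LiTheory

open Literature.NumberTheory.LFunctions Literature.NumberTheory.LFunctions.SchoenfeldBound

/-- `0 ≤ f_n(t) = 1 − cos(nθ(t))`. -/
theorem liWindowWeight_nonneg (n : ℕ) (t : ℝ) : 0 ≤ liWindowWeight n t := by
  unfold liWindowWeight
  linarith [Real.cos_le_one (n * liZeroAngle t)]

/-- `f_n(t) = 1 − cos(nθ(t)) ≤ 2`. -/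
theorem liWindowWeight_le_two (n : ℕ) (t : ℝ) : liWindowWeight n t ≤ 2 := by
  unfold liWindowWeight
  linarith [Real.neg_one_le_cos (n * liZeroAngle t)]

/-- `N(a) = Σ_{0 < Im ρ ≤ a} m(ρ)` for `a ≥ 0`. -/
theorem zetaZeroCount_eq_sum_zerosBetween {a : ℝ} (ha : 0 ≤ a) :
    (zetaZeroCount a : ℝ) = ∑ ρ ∈ zerosBetween 0 a, (riemannZetaZeroOrder ρ : ℝ) := by
  have h := zetaZeroCount_sub_eq_sum ha
  rw [zetaZeroCount_eq_zero_of_nonpos le_rfl, Nat.cast_zero, sub_zero] at h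
  exact h

/-- `M(a) = liCountMain a ≥ 0` once `a ≥ 30` (indeed once `a ≥ 2πe ≈ 17.08`). -/
theorem liCountMain_nonneg {a : ℝ} (ha : 30 ≤ a) : 0 ≤ liCountMain a := by
  unfold liCountMain
  have hπ := Real.pi_pos
  have hπ4 : π < 4 := Real.pi_lt_four
  have he : Real.exp 1 < 3 := lt_trans Real.exp_one_lt_d9 (by norm_num)
  have h1 : 1 ≤ a / (2 * π * Real.exp 1) := by
    rw [le_div_iff₀ (by positivity)]
    nlinarith [Real.exp_pos 1]
  exact mul_nonneg (by positivity) (Real.log_nonneg h1)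

/-- **The low zeros counted trivially** (RH-FREE): for every `n` and `a ≥ 30`,
`|2 Σ_{0 < Im ρ ≤ a} m(ρ) f_n(Im ρ) − 2 M(a)| ≤ 2 M(a) + 4 (0.3083 log a + 4.128)`.
This is verbatim the Assembly-skeleton statement `LiLowZerosTrivial` of the route dossier `LiAsymptotic`. -/
theorem liLowZerosTrivial_bound :
    ∀ (n : ℕ) (a : ℝ), 30 ≤ a →
      |2 * (∑ ρ ∈ zerosBetween 0 a, (riemannZetaZeroOrder ρ : ℝ) * liWindowWeight n ρ.im)
          - 2 * liCountMain a|
        ≤ 2 * liCountMain a + 4 * (0.3083 * Real.log a + 4.128) := by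
  intro n a ha
  have ha0 : (0 : ℝ) ≤ a := by linarith
  -- `0 ≤ Σ m f ≤ 2 Σ m = 2 N(a)`
  have hS0 : 0 ≤ ∑ ρ ∈ zerosBetween 0 a, (riemannZetaZeroOrder ρ : ℝ) * liWindowWeight n ρ.im :=
    Finset.sum_nonneg fun ρ hρ ↦
      mul_nonneg (zeroOrder_nonneg_of_mem_zerosBetween le_rfl hρ) (liWindowWeight_nonneg n _)
  have hS2 : ∑ ρ ∈ zerosBetween 0 a, (riemannZetaZeroOrder ρ : ℝ) * liWindowWeight n ρ.im
      ≤ 2 * zetaZeroCount a := by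
    rw [zetaZeroCount_eq_sum_zerosBetween ha0, Finset.mul_sum]
    refine Finset.sum_le_sum fun ρ hρ ↦ ?_
    have hm := zeroOrder_nonneg_of_mem_zerosBetween le_rfl hρ
    have := mul_le_mul_of_nonneg_left (liWindowWeight_le_two n ρ.im) hm
    linarith
  -- the explicit count
  have hN := (abs_le.1 (abs_zetaZeroCount_sub_main_le_explicit ha)).2
  have hM : a / (2 * π) * Real.log (a / (2 * π * Real.exp 1)) = liCountMain a := rfl
  rw [hM] at hN
  have hM0 := liCountMain_nonneg ha
  have hlog : 0 ≤ Real.log a := Real.log_nonneg (by linarith)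
  rw [abs_le]
  constructor <;> nlinarith
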